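import Summits.CriticalPhenomena.Ising3DConformalLimit.Theses.GammaForcesInteraction
import Summits.CriticalPhenomena.Ising3DConformalLimit.Theorems.MoebiusLimitExists.Negative.InversionContent
import Literature.Probability.LatticeModels.CriticalTwoPointBounds
import Literature.Probability.LatticeModels.HighDimPointwiseTriviality
import HarnessLib

/-!
# Birth skeleton (BC3) for the crux `GammaForcesInteraction.GaussianNoPowerDeficiency`
(item stmt-CriticalPhenomena-4748, rank 3, route `GammaForcesInteraction`)

The crux (GW). Write, at `β_c(3)` in the infinite-volume `+` state and for lattice sites `y, a, b`,
`C4(y,a,b) := ⟨σ₀σ_yσ_aσ_b⟩ − ⟨σ₀σ_y⟩⟨σ_aσ_b⟩` (the truncated THERMAL response of the pair `σ₀σ_y`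
to the bond energy `σ_aσ_b`), `P4(y,a,b) := ⟨σ₀σ_a⟩⟨σ_bσ_y⟩ + ⟨σ₀σ_b⟩⟨σ_aσ_y⟩` (its Wick part), and the
bond-summed versions `CB(y,a) := Σ_{b ∼ a} C4(y,a,b)`, `PB(y,a) := Σ_{b ∼ a} P4(y,a,b)` (`b = a ± eᵢ`);
`N_R := Σ_{y,a ∈ B_R} CB(y,a)`, `W_R := Σ_{y,a ∈ B_R} PB(y,a)`. (GW) says: if `S` is a non-degenerate,
translation-invariant, scale-covariant pointwise scaling limit of `criticalCorr 3` with `U₄^S ≡ 0`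
(a GAUSSIAN limit), then the critical thermal deficiency is not power-small:
`∀ κ > 0, R^{−κ} W_R < N_R` for all large `R`.

## The line: localise to macroscopically separated insertions, then split SHAPE from RATE

The double box sum `N_R` mixes three regimes: (a) degenerate configurations (`y = 0`, where
`C4(0,a,b) = 0` identically while `P4 > 0`, so NO pointwise statement can hold there), (b) mesoscopic
ones, and (c) MACROSCOPICALLY SEPARATED ones, `‖y‖, ‖a‖, ‖y − a‖ ≥ R/4`, the only regime a continuum
`(Φ, E)` scaling theory speaks about. GKS II (`C4 ≥ 0` termwise, tree theorem
`MoebiusLimitExistsNegative.criticalCorr_four_ge`) lets one DROP regimes (a)–(b) from `N_R`; the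
Wick mass is not lost in doing so (stub 3); and on regime (c) the crux factorises into a SHAPE
statement (stub 1: the bond deficiency ratio `CB/PB` is comparable across separated configurations
at one scale — existence and positivity of the thermal three-point scaling profile, the (EM)+chaos
half of the card) and a RATE statement at ONE reference configuration (stub 2: no power deficiency at
`(R e₀, R e₁)` — the sharpness / non-zero `:Φ²:`-content half, the route's bet).

* `stub_thermalRatioHarnack` (SHAPE; (EM) + Wiener-chaos structure of a `Φ`-measurable energy
  field in a Gaussian limit; L–XL): under the crux hypotheses there is `A > 0` such that for all
  large `R` and all separated `(y,a), (y',a') ∈ B_R²`: `CB(y',a')·PB(y,a) ≤ A·CB(y,a)·PB(y',a')`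
  (i.e. `CB/PB (y',a') ≤ A · CB/PB (y,a)`; normalisation-free).
* `stub_axisNoPowerDeficiency` (RATE at the reference configuration; ABF-sharpness ⇒ the energy
  couples to a relevant even field with non-zero `:Φ²:` content; XL, load-bearing): under the crux
  hypotheses, `∀ κ > 0`, eventually `R^{−κ}·PB(R e₀, R e₁) ≤ CB(R e₀, R e₁)`.
* `stub_wickMassSeparated` (lattice harmonic analysis of the TWO-point function only — no
  Gaussianity assumed; L): under the two-point part of the hypotheses (pointwise limit,
  non-degenerate, translation invariant, scale covariant) some family `T` of separated pairs of
  `B_R²` carries a fixed fraction of the Wick mass: `η·W_R ≤ Σ_{(y,a) ∈ T} PB(y,a)` for all large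
  `R` (regular variation of `⟨σ₀σ_x⟩` with index `−2Δ ∈ [−2,−1]`, `scalingDimension_mem_Icc_holds`;
  Messager–Miracle-Solé monotonicity + dyadic doubling from the scaling limit replace Karamata).

`GaussianNoPowerDeficiency_of_hyps` is the real proof (no `sorry`) of the crux statement from the
three stub STATEMENTS: an abstract summation lemma `eventually_deficiency_lt` (pure real analysis on
`CB, PB ≥ 0`: Harnack against the reference pair + rate at the reference pair give
`CB ≥ A⁻¹R^{−κ/2}PB` on every separated pair; sum over `T`, compare with `η W_R`, drop the rest of
`N_R` by positivity, and absorb `A⁻¹η` into `R^{−κ/2}`), fed with the lattice positivity facts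
(GKS II `criticalCorr_four_ge`; `⟨σ_uσ_v⟩_{β_c} > 0` from `criticalTwoPoint_bounds_holds` and
`criticalTwoPoint_zero'`) and the bookkeeping `R eⱼ ∈ B_R`, `‖R e₀‖, ‖R e₁‖, ‖R e₀ − R e₁‖ ≥ R/4`.
`GaussianNoPowerDeficiency_of : GaussianNoPowerDeficiency` applies it to the three declared stubs
and so concludes the crux BY NAME. No `sorry` outside the three `stub_*`.

Disproof used: none relevant — `ledger crux ls stmt-CriticalPhenomena-4748` shows no `Disproof.lean`
and no `Negative/` lemma for this crux (2026-08-17); `ledger negatives --problem CriticalPhenomena`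
has no entry touching (GW). The obstruction honoured by the cut is the elementary one recorded above:
`C4(0,a,b) = 0` (regime (a)), which forbids any all-configurations pointwise version of stub 2 and
forces the separated localisation + stub 3.
-/

noncomputable section

namespace Summit.CriticalPhenomena.Ising3DConformalLimit.Cruxes.GaussianNoPowerDeficiency.Birth

open Filter Finset
open scoped BigOperators Topology
open Literature.Probability.LatticeModels
open Summit.CriticalPhenomena.Ising3DConformalLimit.Theses.GammaForcesInteraction (GaussianNoPowerDeficiency)

/-! ### Stub 1 — SHAPE: Harnack comparability of the bond deficiency ratio on separated pairs -/

/-- **Stub 1 (thermal-ratio Harnack inequality on macroscopically separated pairs).** For every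
renormalisation `ρ > 0` on `(0,1]`, `Δ` and `S`: if `S` is a pointwise scaling limit of
`criticalCorr 3`, non-degenerate, translation invariant, scale covariant with dimension `Δ` and with
`U₄^S ≡ 0` on non-coincident configurations, then there is `A > 0` such that for all large `R`, for
all pairs `(y,a)` and `(y',a')` of `B_R = box 3 R` with `‖y‖, ‖a‖, ‖y−a‖ ≥ R/4` (resp. primed),
`CB(y',a') · PB(y,a) ≤ A · (CB(y,a) · PB(y',a'))` — the bond-summed thermal response over its Wick
part, `CB/PB ∈ [0,1]`, is comparable across the separated set at one scale. Intended proof: the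
rescaled thermal three-point function `Z(δ)ρ(δ)² CB([ŷ/δ],[â/δ])` has, for SOME normalisation `Z`,
a locally uniform limit on non-coincident `(0,ŷ,â)` which is continuous and positive on the compact
separated set (in a Gaussian limit with `Φ`-measurable energy: the leading `Φ`-content of the
lattice energy is an even local field, and its mixed three-point function with `Φ(0)Φ(ŷ)` is a
positive continuous profile, `∝ S₂(0,â)S₂(â,ŷ)` in the `:Φ²:` case), while `ρ(δ)⁴ PB → 12·S₂S₂`;
ratios of two positive continuous functions on a compact set are bounded. Why it might fail: the
thermal three-point function may have no scaling profile at all (oscillating normalisation), or its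
leading profile may vanish on part of the separated set (e.g. a derivative field as leading energy
content), breaking comparability. Size L–XL. -/
theorem stub_thermalRatioHarnack :
    let G2 : Site 3 → Site 3 → ℝ := fun u v => criticalCorr 3 2 ![u, v]
    let C4 : Site 3 → Site 3 → Site 3 → ℝ := fun y a b => criticalCorr 3 4 ![0, y, a, b] - G2 0 y * G2 a b
    let P4 : Site 3 → Site 3 → Site 3 → ℝ := fun y a b => G2 0 a * G2 b y + G2 0 b * G2 a y
    let CB : Site 3 → Site 3 → ℝ := fun y a =>
      ∑ i : Fin 3, (C4 y a (a + Pi.single i 1) + C4 y a (a - Pi.single i 1))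
    let PB : Site 3 → Site 3 → ℝ := fun y a =>
      ∑ i : Fin 3, (P4 y a (a + Pi.single i 1) + P4 y a (a - Pi.single i 1))
    ∀ (ρ : ℝ → ℝ) (Δ : ℝ) (S : CorrFamily 3),
      (∀ δ ∈ Set.Ioc (0:ℝ) 1, 0 < ρ δ) →
      HasPointwiseScalingLimit (criticalCorr 3) ρ S →
      IsNondegenerateTwoPoint S →
      IsTranslationInvariant S →
      IsScaleCovariant Δ S →
      ¬ HasNontrivialU4 S →
      ∃ A : ℝ, 0 < A ∧ ∀ᶠ R : ℕ in Filter.atTop,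
        ∀ y ∈ box 3 R, ∀ a ∈ box 3 R,
          ((R : ℝ) / 4 ≤ ‖y‖ ∧ (R : ℝ) / 4 ≤ ‖a‖ ∧ (R : ℝ) / 4 ≤ ‖y - a‖) →
        ∀ y' ∈ box 3 R, ∀ a' ∈ box 3 R,
          ((R : ℝ) / 4 ≤ ‖y'‖ ∧ (R : ℝ) / 4 ≤ ‖a'‖ ∧ (R : ℝ) / 4 ≤ ‖y' - a'‖) →
        CB y' a' * PB y a ≤ A * (CB y a * PB y' a') := by
  sorry

/-! ### Stub 2 — RATE: no power deficiency at the reference configuration `(R e₀, R e₁)` -/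

/-- **Stub 2 (axis no-power-deficiency; the load-bearing bet).** For every renormalisation `ρ > 0`
on `(0,1]`, `Δ` and `S`: if `S` is a pointwise scaling limit of `criticalCorr 3`, non-degenerate,
translation invariant, scale covariant with dimension `Δ` and with `U₄^S ≡ 0` on non-coincident
configurations, then at the reference pair `y_R = R e₀`, `a_R = R e₁` the bond-summed thermal
response is not power-small against its Wick part: for every `κ > 0`, eventually in `R`,
`R^{−κ} · PB(y_R, a_R) ≤ CB(y_R, a_R)`. Intended proof (the card's (T3)+(T4)): in a Gaussian limit
the energy field `E = lim Z(δ)δ³Σ h(δa)(σ_aσ_{a+e} − ⟨·⟩)` is `Φ`-measurable, chaos orthogonality gives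
`⟨ΦΦ;E⟩ = ⟨ΦΦ;E₂⟩` with `E₂ = c:Φ²:`, and sharpness of the transition (Aizenman–Barsky–Fernández
1987) forces the energy to couple to a RELEVANT even field, whence `c ≠ 0` and
`CB/PB (y_R,a_R) → c' > 0` up to slowly varying factors — in particular no power decay. Why it might
fail: the lattice energy may flow to `:Φ⁴:` with zero `:Φ²:` content (`c = 0`), allowed whenever
`Δ_σ < 3/4` (`η ≤ 1/2` only, DCP2025 Thm 1.5), giving `CB/PB ~ R^{−2Δ_σ}`; this stub is then false
and the route pivots (crux `EnergyHasPhiSquaredContent`). In the actual (conjecturally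
non-Gaussian) model `CB/PB ≍ R^{2Δ_σ−Δ_ε} ≈ R^{−0.376}`, so the stub is provable only as a genuine
implication from Gaussianity. Size XL. -/
theorem stub_axisNoPowerDeficiency :
    let G2 : Site 3 → Site 3 → ℝ := fun u v => criticalCorr 3 2 ![u, v]
    let C4 : Site 3 → Site 3 → Site 3 → ℝ := fun y a b => criticalCorr 3 4 ![0, y, a, b] - G2 0 y * G2 a b
    let P4 : Site 3 → Site 3 → Site 3 → ℝ := fun y a b => G2 0 a * G2 b y + G2 0 b * G2 a y
    let CB : Site 3 → Site 3 → ℝ := fun y a =>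
      ∑ i : Fin 3, (C4 y a (a + Pi.single i 1) + C4 y a (a - Pi.single i 1))
    let PB : Site 3 → Site 3 → ℝ := fun y a =>
      ∑ i : Fin 3, (P4 y a (a + Pi.single i 1) + P4 y a (a - Pi.single i 1))
    ∀ (ρ : ℝ → ℝ) (Δ : ℝ) (S : CorrFamily 3),
      (∀ δ ∈ Set.Ioc (0:ℝ) 1, 0 < ρ δ) →
      HasPointwiseScalingLimit (criticalCorr 3) ρ S →
      IsNondegenerateTwoPoint S →
      IsTranslationInvariant S →
      IsScaleCovariant Δ S →
      ¬ HasNontrivialU4 S →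
      ∀ κ : ℝ, 0 < κ → ∀ᶠ R : ℕ in Filter.atTop,
        (R : ℝ) ^ (-κ) * PB (Pi.single 0 (R : ℤ)) (Pi.single 1 (R : ℤ)) ≤
          CB (Pi.single 0 (R : ℤ)) (Pi.single 1 (R : ℤ)) := by
  sorry

/-! ### Stub 3 — the separated pairs carry a fixed fraction of the Wick mass (two-point only) -/

/-- **Stub 3 (Wick mass on separated pairs).** For every renormalisation `ρ > 0` on `(0,1]`, `Δ`
and `S`: if `S` is a pointwise scaling limit of `criticalCorr 3`, non-degenerate, translation
invariant and scale covariant with dimension `Δ` (NO Gaussianity assumed), then there is `η > 0`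
such that for all large `R` some finite family `T` of pairs `(y,a) ∈ B_R²` with
`‖y‖, ‖a‖, ‖y−a‖ ≥ R/4` satisfies `η · W_R ≤ Σ_{(y,a) ∈ T} PB(y,a)`. Intended proof: the two-point
function `G(x) = ⟨σ₀σ_x⟩_{β_c}` is comparable to `ρ(1/‖x‖)^{−2}` with `ρ` regularly varying of
index `−Δ`, `Δ ∈ [1/2,1]` (`scalingDimension_mem_Icc_holds`), so box sums `Σ_{‖x‖ ≤ L} G(x)` have
no mass concentration at the origin (`3 − 2Δ ≥ 1 > 0`) and obey doubling; `W_R` is then within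
constants of `(Σ_{B_R} G)²` and so is its separated part (Riemann sums of the continuous positive
limit `S₂(0,â)S₂(b̂,ŷ)` over the separated set). Tools: Messager–Miracle-Solé / sup-norm
monotonicity of `G` (tree `TwoPointSupNormMonotone`), dyadic ratio limits from the scaling
hypothesis, `criticalTwoPoint_bounds_holds`. Why it might fail: it should not (true for every
regularly varying two-point function of index `> −3`); the work is the Karamata-free lattice
bookkeeping. Size L. -/
theorem stub_wickMassSeparated :
    let G2 : Site 3 → Site 3 → ℝ := fun u v => criticalCorr 3 2 ![u, v]
    let P4 : Site 3 → Site 3 → Site 3 → ℝ := fun y a b => G2 0 a * G2 b y + G2 0 b * G2 a y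
    let PB : Site 3 → Site 3 → ℝ := fun y a =>
      ∑ i : Fin 3, (P4 y a (a + Pi.single i 1) + P4 y a (a - Pi.single i 1))
    ∀ (ρ : ℝ → ℝ) (Δ : ℝ) (S : CorrFamily 3),
      (∀ δ ∈ Set.Ioc (0:ℝ) 1, 0 < ρ δ) →
      HasPointwiseScalingLimit (criticalCorr 3) ρ S →
      IsNondegenerateTwoPoint S →
      IsTranslationInvariant S →
      IsScaleCovariant Δ S →
      ∃ η : ℝ, 0 < η ∧ ∀ᶠ R : ℕ in Filter.atTop, ∃ T : Finset (Site 3 × Site 3),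
        (∀ p ∈ T, p.1 ∈ box 3 R ∧ p.2 ∈ box 3 R ∧
          ((R : ℝ) / 4 ≤ ‖p.1‖ ∧ (R : ℝ) / 4 ≤ ‖p.2‖ ∧ (R : ℝ) / 4 ≤ ‖p.1 - p.2‖)) ∧
        η * (∑ y ∈ box 3 R, ∑ a ∈ box 3 R, PB y a) ≤ ∑ p ∈ T, PB p.1 p.2 := by
  sorry

/-! ### The abstract summation lemma (pure real analysis; sorry-free) -/

/-- **Deficiency from Harnack + axis rate + separated Wick mass** (abstract form of the composition).
For functions `CB, PB ≥ 0` on pairs of sites, a separation predicate `sep` and reference pairs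
`(y_R, a_R)` that are separated, lie in `B_R` and have `PB(y_R,a_R) > 0`, `W_R > 0`: Harnack
comparability of `CB/PB` on separated pairs, the rate bound `R^{−κ}PB ≤ CB` at the reference pair
for every `κ > 0`, and an `η`-fraction of `W_R = ΣΣ PB` carried by separated pairs give
`R^{−κ} W_R < N_R = ΣΣ CB` eventually, for every `κ > 0`. [folklore] -/
theorem eventually_deficiency_lt
    (CB PB : Site 3 → Site 3 → ℝ) (sep : ℕ → Site 3 → Site 3 → Prop) (yR aR : ℕ → Site 3)
    (hCB : ∀ y a, 0 ≤ CB y a) (hPB : ∀ y a, 0 ≤ PB y a)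
    (hPBref : ∀ R, 0 < PB (yR R) (aR R))
    (hWpos : ∀ R, 0 < ∑ y ∈ box 3 R, ∑ a ∈ box 3 R, PB y a)
    (href : ∀ R, yR R ∈ box 3 R ∧ aR R ∈ box 3 R ∧ sep R (yR R) (aR R))
    (hH : ∃ A : ℝ, 0 < A ∧ ∀ᶠ R : ℕ in Filter.atTop, ∀ y ∈ box 3 R, ∀ a ∈ box 3 R, sep R y a →
      ∀ y' ∈ box 3 R, ∀ a' ∈ box 3 R, sep R y' a' → CB y' a' * PB y a ≤ A * (CB y a * PB y' a'))
    (hX : ∀ κ : ℝ, 0 < κ → ∀ᶠ R : ℕ in Filter.atTop,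
      (R : ℝ) ^ (-κ) * PB (yR R) (aR R) ≤ CB (yR R) (aR R))
    (hW : ∃ η : ℝ, 0 < η ∧ ∀ᶠ R : ℕ in Filter.atTop, ∃ T : Finset (Site 3 × Site 3),
      (∀ p ∈ T, p.1 ∈ box 3 R ∧ p.2 ∈ box 3 R ∧ sep R p.1 p.2) ∧
      η * (∑ y ∈ box 3 R, ∑ a ∈ box 3 R, PB y a) ≤ ∑ p ∈ T, PB p.1 p.2) :
    ∀ κ : ℝ, 0 < κ → ∀ᶠ R : ℕ in Filter.atTop,
      (R : ℝ) ^ (-κ) * (∑ y ∈ box 3 R, ∑ a ∈ box 3 R, PB y a) <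
        ∑ y ∈ box 3 R, ∑ a ∈ box 3 R, CB y a := by
  intro κ hκ
  obtain ⟨A, hA, hH⟩ := hH
  obtain ⟨η, hη, hW⟩ := hW
  have hκ2 : 0 < κ / 2 := half_pos hκ
  have hgrow : ∀ᶠ R : ℕ in Filter.atTop, A / η < (R : ℝ) ^ (κ / 2) :=
    ((tendsto_rpow_atTop hκ2).comp tendsto_natCast_atTop_atTop).eventually_gt_atTop (A / η)
  filter_upwards [hH, hX (κ / 2) hκ2, hW, hgrow, Filter.eventually_ge_atTop 1]
    with R hHR hXR hWR hgR hR1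
  obtain ⟨T, hTsep, hTmass⟩ := hWR
  obtain ⟨hyR, haR, hsR⟩ := href R
  have hRpos : (0 : ℝ) < R := Nat.cast_pos.2 (by omega)
  have hPr : 0 < PB (yR R) (aR R) := hPBref R
  -- Step 1: on every separated pair of `T`, Harnack against the reference pair and the rate bound
  -- at the reference pair give `R^{-κ/2} PB ≤ A CB`.
  have hpt : ∀ p ∈ T, (R : ℝ) ^ (-(κ / 2)) * PB p.1 p.2 ≤ A * CB p.1 p.2 := by
    intro p hp
    obtain ⟨hp1, hp2, hps⟩ := hTsep p hp
    have h1 : CB (yR R) (aR R) * PB p.1 p.2 ≤ A * (CB p.1 p.2 * PB (yR R) (aR R)) :=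
      hHR p.1 hp1 p.2 hp2 hps (yR R) hyR (aR R) haR hsR
    have h2 : (R : ℝ) ^ (-(κ / 2)) * PB p.1 p.2 * PB (yR R) (aR R) ≤
        A * CB p.1 p.2 * PB (yR R) (aR R) := by
      calc (R : ℝ) ^ (-(κ / 2)) * PB p.1 p.2 * PB (yR R) (aR R)
          = ((R : ℝ) ^ (-(κ / 2)) * PB (yR R) (aR R)) * PB p.1 p.2 := by ring
        _ ≤ CB (yR R) (aR R) * PB p.1 p.2 := mul_le_mul_of_nonneg_right hXR (hPB _ _)
        _ ≤ A * (CB p.1 p.2 * PB (yR R) (aR R)) := h1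
        _ = A * CB p.1 p.2 * PB (yR R) (aR R) := by ring
    exact le_of_mul_le_mul_right h2 hPr
  -- Step 2: sum over `T`; `T ⊆ B_R × B_R` and `CB ≥ 0` bound the `T`-sum of `CB` by `N_R`.
  have hsumT : (R : ℝ) ^ (-(κ / 2)) * ∑ p ∈ T, PB p.1 p.2 ≤ A * ∑ p ∈ T, CB p.1 p.2 := by
    rw [Finset.mul_sum, Finset.mul_sum]
    exact Finset.sum_le_sum hpt
  have hTsub : ∑ p ∈ T, CB p.1 p.2 ≤ ∑ y ∈ box 3 R, ∑ a ∈ box 3 R, CB y a := by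
    calc ∑ p ∈ T, CB p.1 p.2 ≤ ∑ p ∈ box 3 R ×ˢ box 3 R, CB p.1 p.2 :=
          Finset.sum_le_sum_of_subset_of_nonneg
            (fun p hp => Finset.mem_product.2 ⟨(hTsep p hp).1, (hTsep p hp).2.1⟩)
            (fun p _ _ => hCB p.1 p.2)
      _ = ∑ y ∈ box 3 R, ∑ a ∈ box 3 R, CB y a := Finset.sum_product' _ _ _
  have hmain : (R : ℝ) ^ (-(κ / 2)) * (η * ∑ y ∈ box 3 R, ∑ a ∈ box 3 R, PB y a) ≤
      A * ∑ y ∈ box 3 R, ∑ a ∈ box 3 R, CB y a := by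
    calc (R : ℝ) ^ (-(κ / 2)) * (η * ∑ y ∈ box 3 R, ∑ a ∈ box 3 R, PB y a)
        ≤ (R : ℝ) ^ (-(κ / 2)) * ∑ p ∈ T, PB p.1 p.2 :=
          mul_le_mul_of_nonneg_left hTmass (Real.rpow_nonneg hRpos.le _)
      _ ≤ A * ∑ p ∈ T, CB p.1 p.2 := hsumT
      _ ≤ A * ∑ y ∈ box 3 R, ∑ a ∈ box 3 R, CB y a := mul_le_mul_of_nonneg_left hTsub hA.le
  -- Step 3: absorb the constant `A/η` into the spare half power `R^{-κ/2}`.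
  have hwpos : 0 < ∑ y ∈ box 3 R, ∑ a ∈ box 3 R, PB y a := hWpos R
  have hhalf : (R : ℝ) ^ (-(κ / 2)) < η / A := by
    have hAη : 0 < A / η := div_pos hA hη
    rw [Real.rpow_neg hRpos.le, show η / A = (A / η)⁻¹ by rw [inv_div]]
    exact (inv_lt_inv₀ (Real.rpow_pos_of_pos hRpos _) hAη).2 hgR
  have hkey : (R : ℝ) ^ (-κ) * (∑ y ∈ box 3 R, ∑ a ∈ box 3 R, PB y a) <
      (η / A) * ((R : ℝ) ^ (-(κ / 2)) * ∑ y ∈ box 3 R, ∑ a ∈ box 3 R, PB y a) := by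
    have e : (R : ℝ) ^ (-κ) = (R : ℝ) ^ (-(κ / 2)) * (R : ℝ) ^ (-(κ / 2)) := by
      rw [← Real.rpow_add hRpos]; congr 1; ring
    rw [e, mul_assoc]
    exact mul_lt_mul_of_pos_right hhalf (mul_pos (Real.rpow_pos_of_pos hRpos _) hwpos)
  calc (R : ℝ) ^ (-κ) * (∑ y ∈ box 3 R, ∑ a ∈ box 3 R, PB y a)
      < (η / A) * ((R : ℝ) ^ (-(κ / 2)) * ∑ y ∈ box 3 R, ∑ a ∈ box 3 R, PB y a) := hkey
    _ = A⁻¹ * ((R : ℝ) ^ (-(κ / 2)) * (η * ∑ y ∈ box 3 R, ∑ a ∈ box 3 R, PB y a)) := by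
          rw [div_eq_mul_inv]; ring
    _ ≤ A⁻¹ * (A * ∑ y ∈ box 3 R, ∑ a ∈ box 3 R, CB y a) :=
          mul_le_mul_of_nonneg_left hmain (inv_nonneg.2 hA.le)
    _ = ∑ y ∈ box 3 R, ∑ a ∈ box 3 R, CB y a := by
          rw [← mul_assoc, inv_mul_cancel₀ hA.ne', one_mul]

/-! ### Lattice positivity and bookkeeping facts used by the composition (sorry-free) -/

/-- `⟨σ₀σ_x⟩_{β_c} > 0` on `ℤ³` (Simon–Lieb lower bound off the origin; `= 1` at it). [folklore] -/
theorem criticalTwoPoint_pos_birth (x : Site 3) : 0 < criticalTwoPoint 3 x := by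
  by_cases hx : x = 0
  · rw [hx, criticalTwoPoint_zero']; exact one_pos
  · obtain ⟨c, C, hc, hb⟩ := criticalTwoPoint_bounds_holds (d := 3) le_rfl
    exact lt_of_lt_of_le (mul_pos hc (Real.rpow_pos_of_pos (norm_pos_iff.2 hx) _)) (hb _ hx).1

/-- `⟨σ_uσ_v⟩_{β_c} > 0` for all `u, v ∈ ℤ³`. [folklore] -/
theorem G2_pos (u v : Site 3) : 0 < criticalCorr 3 2 ![u, v] := by
  rw [criticalCorr_two_pair]; exact criticalTwoPoint_pos_birth _

/-- GKS II for the truncated thermal response: `⟨σ₀σ_yσ_aσ_b⟩ − ⟨σ₀σ_y⟩⟨σ_aσ_b⟩ ≥ 0`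
(tree `criticalCorr_four_ge`). [folklore] -/
theorem C4_nonneg (y a b : Site 3) :
    0 ≤ criticalCorr 3 4 ![0, y, a, b] - criticalCorr 3 2 ![0, y] * criticalCorr 3 2 ![a, b] := by
  have h := Summit.CriticalPhenomena.Ising3DConformalLimit.MoebiusLimitExistsNegative.criticalCorr_four_ge
    ![0, y, a, b]
  have e0 : (![0, y, a, b] : Fin 4 → Site 3) 0 = 0 := rfl
  have e1 : (![0, y, a, b] : Fin 4 → Site 3) 1 = y := rfl
  have e2 : (![0, y, a, b] : Fin 4 → Site 3) 2 = a := rfl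
  have e3 : (![0, y, a, b] : Fin 4 → Site 3) 3 = b := rfl
  rw [e0, e1, e2, e3] at h
  linarith

/-- The Wick part of one bond term is positive. [folklore] -/
theorem P4_pos (y a b : Site 3) :
    0 < criticalCorr 3 2 ![0, a] * criticalCorr 3 2 ![b, y] +
      criticalCorr 3 2 ![0, b] * criticalCorr 3 2 ![a, y] :=
  add_pos (mul_pos (G2_pos _ _) (G2_pos _ _)) (mul_pos (G2_pos _ _) (G2_pos _ _))

/-- The bond-summed thermal response `CB(y,a) ≥ 0`. [folklore] -/
theorem CB_nonneg (y a : Site 3) :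
    0 ≤ ∑ i : Fin 3,
      ((criticalCorr 3 4 ![0, y, a, a + Pi.single i 1] -
          criticalCorr 3 2 ![0, y] * criticalCorr 3 2 ![a, a + Pi.single i 1]) +
        (criticalCorr 3 4 ![0, y, a, a - Pi.single i 1] -
          criticalCorr 3 2 ![0, y] * criticalCorr 3 2 ![a, a - Pi.single i 1])) :=
  Finset.sum_nonneg fun _ _ => add_nonneg (C4_nonneg _ _ _) (C4_nonneg _ _ _)

/-- The bond-summed Wick part `PB(y,a) > 0`. [folklore] -/
theorem PB_pos (y a : Site 3) :
    0 < ∑ i : Fin 3,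
      ((criticalCorr 3 2 ![0, a] * criticalCorr 3 2 ![a + Pi.single i 1, y] +
          criticalCorr 3 2 ![0, a + Pi.single i 1] * criticalCorr 3 2 ![a, y]) +
        (criticalCorr 3 2 ![0, a] * criticalCorr 3 2 ![a - Pi.single i 1, y] +
          criticalCorr 3 2 ![0, a - Pi.single i 1] * criticalCorr 3 2 ![a, y])) :=
  Finset.sum_pos (fun _ _ => add_pos (P4_pos _ _ _) (P4_pos _ _ _)) Finset.univ_nonempty

/-- `R eⱼ ∈ B_R`. [folklore] -/
theorem single_mem_box (R : ℕ) (j : Fin 3) : (Pi.single j (R : ℤ) : Site 3) ∈ box 3 R := by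
  rw [mem_box]
  intro i
  by_cases h : i = j
  · subst h; simp
  · simp [h]

/-- `‖R eⱼ‖ ≥ R/4`. [folklore] -/
theorem norm_single_ge (R : ℕ) (j : Fin 3) : (R : ℝ) / 4 ≤ ‖(Pi.single j (R : ℤ) : Site 3)‖ := by
  have h1 : ‖(Pi.single j (R : ℤ) : Site 3) j‖ ≤ ‖(Pi.single j (R : ℤ) : Site 3)‖ :=
    norm_le_pi_norm _ j
  rw [Pi.single_eq_same, Int.norm_natCast] at h1
  linarith [(Nat.cast_nonneg R : (0 : ℝ) ≤ R)]

/-- `‖R e₀ − R e₁‖ ≥ R/4`. [folklore] -/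
theorem norm_single_sub_single_ge (R : ℕ) :
    (R : ℝ) / 4 ≤ ‖(Pi.single 0 (R : ℤ) : Site 3) - Pi.single 1 (R : ℤ)‖ := by
  have h1 := norm_le_pi_norm ((Pi.single 0 (R : ℤ) : Site 3) - Pi.single 1 (R : ℤ)) 0
  have e : (((Pi.single 0 (R : ℤ) : Site 3) - Pi.single 1 (R : ℤ) : Site 3)) 0 = (R : ℤ) := by
    simp
  rw [e, Int.norm_natCast] at h1
  linarith [(Nat.cast_nonneg R : (0 : ℝ) ≤ R)]

/-! ### The composition: the three stub statements give the crux

Two spellings of the same real proof: `GaussianNoPowerDeficiency_of_hyps` takes the three stub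
STATEMENTS as explicit hypotheses and concludes the crux's definiens (sorry-free; the composition
credits nothing to `sorry`); `GaussianNoPowerDeficiency_of` feeds it the three declared stubs and
concludes the crux BY NAME (the shape audited by `#h21_check_skeleton`: no hypotheses, `sorry` only
inside `stub_*`). -/

/-- **The crux statement from the three stub statements** (hypotheses = the statements of
`stub_thermalRatioHarnack`, `stub_axisNoPowerDeficiency`, `stub_wickMassSeparated`, verbatim;
conclusion = the definiens of `GaussianNoPowerDeficiency`; real proof, no `sorry`): zeta-reduce the
`let`s, fix `(ρ, Δ, S)` with the crux hypotheses, and apply `eventually_deficiency_lt` to the lattice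
`CB`, `PB`, the separation predicate `‖y‖, ‖a‖, ‖y−a‖ ≥ R/4` and the reference pairs `(R e₀, R e₁)`,
discharging positivity by GKS II (`C4_nonneg`) and `G2_pos`, and the bookkeeping by
`single_mem_box`, `norm_single_ge`, `norm_single_sub_single_ge`. [folklore] -/
theorem GaussianNoPowerDeficiency_of_hyps
    (hH : let G2 : Site 3 → Site 3 → ℝ := fun u v => criticalCorr 3 2 ![u, v]
      let C4 : Site 3 → Site 3 → Site 3 → ℝ := fun y a b => criticalCorr 3 4 ![0, y, a, b] - G2 0 y * G2 a b
      let P4 : Site 3 → Site 3 → Site 3 → ℝ := fun y a b => G2 0 a * G2 b y + G2 0 b * G2 a y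
      let CB : Site 3 → Site 3 → ℝ := fun y a =>
        ∑ i : Fin 3, (C4 y a (a + Pi.single i 1) + C4 y a (a - Pi.single i 1))
      let PB : Site 3 → Site 3 → ℝ := fun y a =>
        ∑ i : Fin 3, (P4 y a (a + Pi.single i 1) + P4 y a (a - Pi.single i 1))
      ∀ (ρ : ℝ → ℝ) (Δ : ℝ) (S : CorrFamily 3),
        (∀ δ ∈ Set.Ioc (0:ℝ) 1, 0 < ρ δ) →
        HasPointwiseScalingLimit (criticalCorr 3) ρ S →
        IsNondegenerateTwoPoint S →
        IsTranslationInvariant S →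
        IsScaleCovariant Δ S →
        ¬ HasNontrivialU4 S →
        ∃ A : ℝ, 0 < A ∧ ∀ᶠ R : ℕ in Filter.atTop,
          ∀ y ∈ box 3 R, ∀ a ∈ box 3 R,
            ((R : ℝ) / 4 ≤ ‖y‖ ∧ (R : ℝ) / 4 ≤ ‖a‖ ∧ (R : ℝ) / 4 ≤ ‖y - a‖) →
          ∀ y' ∈ box 3 R, ∀ a' ∈ box 3 R,
            ((R : ℝ) / 4 ≤ ‖y'‖ ∧ (R : ℝ) / 4 ≤ ‖a'‖ ∧ (R : ℝ) / 4 ≤ ‖y' - a'‖) →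
          CB y' a' * PB y a ≤ A * (CB y a * PB y' a'))
    (hX : let G2 : Site 3 → Site 3 → ℝ := fun u v => criticalCorr 3 2 ![u, v]
      let C4 : Site 3 → Site 3 → Site 3 → ℝ := fun y a b => criticalCorr 3 4 ![0, y, a, b] - G2 0 y * G2 a b
      let P4 : Site 3 → Site 3 → Site 3 → ℝ := fun y a b => G2 0 a * G2 b y + G2 0 b * G2 a y
      let CB : Site 3 → Site 3 → ℝ := fun y a =>
        ∑ i : Fin 3, (C4 y a (a + Pi.single i 1) + C4 y a (a - Pi.single i 1))
      let PB : Site 3 → Site 3 → ℝ := fun y a =>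
        ∑ i : Fin 3, (P4 y a (a + Pi.single i 1) + P4 y a (a - Pi.single i 1))
      ∀ (ρ : ℝ → ℝ) (Δ : ℝ) (S : CorrFamily 3),
        (∀ δ ∈ Set.Ioc (0:ℝ) 1, 0 < ρ δ) →
        HasPointwiseScalingLimit (criticalCorr 3) ρ S →
        IsNondegenerateTwoPoint S →
        IsTranslationInvariant S →
        IsScaleCovariant Δ S →
        ¬ HasNontrivialU4 S →
        ∀ κ : ℝ, 0 < κ → ∀ᶠ R : ℕ in Filter.atTop,
          (R : ℝ) ^ (-κ) * PB (Pi.single 0 (R : ℤ)) (Pi.single 1 (R : ℤ)) ≤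
            CB (Pi.single 0 (R : ℤ)) (Pi.single 1 (R : ℤ)))
    (hW : let G2 : Site 3 → Site 3 → ℝ := fun u v => criticalCorr 3 2 ![u, v]
      let P4 : Site 3 → Site 3 → Site 3 → ℝ := fun y a b => G2 0 a * G2 b y + G2 0 b * G2 a y
      let PB : Site 3 → Site 3 → ℝ := fun y a =>
        ∑ i : Fin 3, (P4 y a (a + Pi.single i 1) + P4 y a (a - Pi.single i 1))
      ∀ (ρ : ℝ → ℝ) (Δ : ℝ) (S : CorrFamily 3),
        (∀ δ ∈ Set.Ioc (0:ℝ) 1, 0 < ρ δ) →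
        HasPointwiseScalingLimit (criticalCorr 3) ρ S →
        IsNondegenerateTwoPoint S →
        IsTranslationInvariant S →
        IsScaleCovariant Δ S →
        ∃ η : ℝ, 0 < η ∧ ∀ᶠ R : ℕ in Filter.atTop, ∃ T : Finset (Site 3 × Site 3),
          (∀ p ∈ T, p.1 ∈ box 3 R ∧ p.2 ∈ box 3 R ∧
            ((R : ℝ) / 4 ≤ ‖p.1‖ ∧ (R : ℝ) / 4 ≤ ‖p.2‖ ∧ (R : ℝ) / 4 ≤ ‖p.1 - p.2‖)) ∧
          η * (∑ y ∈ box 3 R, ∑ a ∈ box 3 R, PB y a) ≤ ∑ p ∈ T, PB p.1 p.2) :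
    let G2 : Site 3 → Site 3 → ℝ := fun u v => criticalCorr 3 2 ![u, v]
    let C4 : Site 3 → Site 3 → Site 3 → ℝ := fun y a b => criticalCorr 3 4 ![0, y, a, b] - G2 0 y * G2 a b
    let P4 : Site 3 → Site 3 → Site 3 → ℝ := fun y a b => G2 0 a * G2 b y + G2 0 b * G2 a y
    let N : ℕ → ℝ := fun R => ∑ y ∈ box 3 R, ∑ a ∈ box 3 R,
      ∑ i : Fin 3, (C4 y a (a + Pi.single i 1) + C4 y a (a - Pi.single i 1))
    let W : ℕ → ℝ := fun R => ∑ y ∈ box 3 R, ∑ a ∈ box 3 R,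
      ∑ i : Fin 3, (P4 y a (a + Pi.single i 1) + P4 y a (a - Pi.single i 1))
    ∀ (ρ : ℝ → ℝ) (Δ : ℝ) (S : CorrFamily 3),
      (∀ δ ∈ Set.Ioc (0:ℝ) 1, 0 < ρ δ) →
      HasPointwiseScalingLimit (criticalCorr 3) ρ S →
      IsNondegenerateTwoPoint S →
      IsTranslationInvariant S →
      IsScaleCovariant Δ S →
      ¬ HasNontrivialU4 S →
      ∀ κ : ℝ, 0 < κ → ∀ᶠ R : ℕ in Filter.atTop, (R : ℝ) ^ (-κ) * W R < N R := by
  dsimp only at hH hX hW ⊢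
  intro ρ Δ S hρ hlim hnd htr hsc hU4
  exact eventually_deficiency_lt
    (fun y a => ∑ i : Fin 3,
      ((criticalCorr 3 4 ![0, y, a, a + Pi.single i 1] -
          criticalCorr 3 2 ![0, y] * criticalCorr 3 2 ![a, a + Pi.single i 1]) +
        (criticalCorr 3 4 ![0, y, a, a - Pi.single i 1] -
          criticalCorr 3 2 ![0, y] * criticalCorr 3 2 ![a, a - Pi.single i 1])))
    (fun y a => ∑ i : Fin 3,
      ((criticalCorr 3 2 ![0, a] * criticalCorr 3 2 ![a + Pi.single i 1, y] +
          criticalCorr 3 2 ![0, a + Pi.single i 1] * criticalCorr 3 2 ![a, y]) +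
        (criticalCorr 3 2 ![0, a] * criticalCorr 3 2 ![a - Pi.single i 1, y] +
          criticalCorr 3 2 ![0, a - Pi.single i 1] * criticalCorr 3 2 ![a, y])))
    (fun R y a => (R : ℝ) / 4 ≤ ‖y‖ ∧ (R : ℝ) / 4 ≤ ‖a‖ ∧ (R : ℝ) / 4 ≤ ‖y - a‖)
    (fun R => Pi.single 0 (R : ℤ)) (fun R => Pi.single 1 (R : ℤ))
    CB_nonneg (fun y a => (PB_pos y a).le) (fun _ => PB_pos _ _)
    (fun _ => Finset.sum_pos (fun y _ => Finset.sum_pos (fun a _ => PB_pos y a)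
      ⟨0, by simp [mem_box]⟩) ⟨0, by simp [mem_box]⟩)
    (fun R => ⟨single_mem_box R 0, single_mem_box R 1, norm_single_ge R 0, norm_single_ge R 1,
      norm_single_sub_single_ge R⟩)
    (hH ρ Δ S hρ hlim hnd htr hsc hU4) (hX ρ Δ S hρ hlim hnd htr hsc hU4)
    (hW ρ Δ S hρ hlim hnd htr hsc)

/-- **The crux `GaussianNoPowerDeficiency` BY NAME from the three declared stubs** (route
`GammaForcesInteraction`, item stmt-CriticalPhenomena-4748) — the skeleton's concluding
declaration. Its only debts are the `sorry`s inside `stub_thermalRatioHarnack`,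
`stub_axisNoPowerDeficiency`, `stub_wickMassSeparated`; the composition itself is
`GaussianNoPowerDeficiency_of_hyps`. -/
theorem GaussianNoPowerDeficiency_of : GaussianNoPowerDeficiency :=
  GaussianNoPowerDeficiency_of_hyps stub_thermalRatioHarnack stub_axisNoPowerDeficiency
    stub_wickMassSeparated

end Summit.CriticalPhenomena.Ising3DConformalLimit.Cruxes.GaussianNoPowerDeficiency.Birth

end
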